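import Mathlib
import Literature.Computability.AlgebraicComplexity.StandardFamilies

/-!
# Crux `ElementaryWordLength.WordPerCubic` (stmt-ValiantsHypothesis-6625), line `Sketch` —
# stub `stub_perPairCoeff` (S3): per's 2-derangement coefficients

Against the shifted transversal block `B_k = {(c + k, c)}` of variables, split off by the algebra map
`φ_k = aeval (v ↦ if v.1 = v.2 + k then X v else C (X v)) : ℂ[x] → (ℂ[x])[x]`, the coefficient in
`φ_k (per_n)`, `per_n = Σ_π ∏_c X (π c, c)`, of the block monomial `∏_{c ∉ {a, b}} X (c + k, c)` is the
single term `X (b + k, a) * X (a + k, b)`: a permutation `π` contributes to that monomial iff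
`{c | π c = c + k} = {a, b}ᶜ`, which forces `π = (swap a b) + k`.
-/

noncomputable section

open MvPolynomial Literature.Computability.AlgebraicComplexity

-- `Summit.ValiantsHypothesis.ValiantsHypothesis.…` is the tree's mandated single-conjunct layout.
set_option linter.dupNamespace false

namespace Summit.ValiantsHypothesis.ValiantsHypothesis.Theorems.ElementaryWordLengthWordPerCubic

/-- The exponent vector `∑_{c ∈ A} e_{(c + k, c)}` of the block monomial `∏_{c ∈ A} X (c + k, c)`,
evaluated at the block position `(c₀ + k, c₀)`, is the indicator of `c₀ ∈ A`. [folklore] -/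
theorem blockExp_apply {n : ℕ} (k : Fin n) (A : Finset (Fin n)) (c₀ : Fin n) :
    (∑ c ∈ A, Finsupp.single (c + k, c) (1 : ℕ)) (c₀ + k, c₀) = if c₀ ∈ A then 1 else 0 := by
  classical
  rw [Finsupp.finsetSum_apply]
  simp_rw [Finsupp.single_apply]
  have h : ∀ c : Fin n, ((c + k, c) = (c₀ + k, c₀)) ↔ c = c₀ := fun c =>
    ⟨fun h => (Prod.mk.inj h).2, fun h => by rw [h]⟩
  simp_rw [h]
  exact Finset.sum_ite_eq' A c₀ (fun _ => 1)

/-- Block monomials with the same exponent vector have the same index set. [folklore] -/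
theorem blockExp_eq_iff {n : ℕ} (k : Fin n) (A B : Finset (Fin n)) :
    (∑ c ∈ A, Finsupp.single (c + k, c) (1 : ℕ)) = ∑ c ∈ B, Finsupp.single (c + k, c) 1 ↔
      A = B := by
  refine ⟨fun h => ?_, fun h => by rw [h]⟩
  ext c₀
  have h1 := congrArg (fun f : (Fin n × Fin n) →₀ ℕ => f (c₀ + k, c₀)) h
  simp only [blockExp_apply] at h1
  by_cases hA : c₀ ∈ A <;> by_cases hB : c₀ ∈ B <;> simp_all

/-- One term of `φ_k (per_n)`: the block split of `∏_c X (π c, c)` is the outer monomial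
`∏_{π c = c + k} X (c + k, c)` with coefficient `∏_{π c ≠ c + k} X (π c, c)`. [folklore] -/
theorem blockSplit_term {n : ℕ} (k : Fin n) (π : Equiv.Perm (Fin n)) :
    (∏ c, if π c = c + k then (X (π c, c) : MvPolynomial (Fin n × Fin n) (MvPolynomial (Fin n × Fin n) ℂ))
      else C (X (π c, c))) =
      monomial (∑ c ∈ Finset.univ.filter (fun c => π c = c + k), Finsupp.single (c + k, c) 1)
        (∏ c ∈ Finset.univ.filter (fun c => ¬ π c = c + k), X (π c, c)) := by
  rw [Finset.prod_ite, ← map_prod C, mul_comm, monomial_sum_index]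
  congr 1
  refine Finset.prod_congr rfl fun c hc => ?_
  rw [(Finset.mem_filter.1 hc).2]
  rfl

/-- S3 — **per's 2-derangement coefficients**: against the block `B_k = {(c + k, c)}`, the coefficient in
`per_n = Σ_π ∏_c X(π c, c)` of the block monomial `∏_{c ∉ {a, b}} X(c + k, c)` is the single term
`X(b + k, a)·X(a + k, b)` (the unique permutation with `{c | π c = c + k} = {a, b}ᶜ`). -/
theorem stub_perPairCoeff (n : ℕ) (k a b : Fin n) (hab : a ≠ b) :
    coeff (∑ c ∈ ({a, b} : Finset (Fin n))ᶜ, Finsupp.single (c + k, c) 1)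
      (aeval (fun v : Fin n × Fin n => if v.1 = v.2 + k
        then (X v : MvPolynomial (Fin n × Fin n) (MvPolynomial (Fin n × Fin n) ℂ))
        else C (X v)) (perPoly (Fin n) ℂ)) = X (b + k, a) * X (a + k, b) := by
  classical
  obtain ⟨n, rfl⟩ : ∃ m, n = m + 1 := ⟨n - 1, (Nat.succ_pred_eq_of_pos (Fin.pos a)).symm⟩
  -- the unique contributing permutation
  set π₀ : Equiv.Perm (Fin (n + 1)) := (Equiv.swap a b).trans (Equiv.addRight k) with hπ₀
  have hπ₀_apply : ∀ c, π₀ c = Equiv.swap a b c + k := fun c => rfl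
  have hfix : ∀ c, π₀ c = c + k ↔ (c ≠ a ∧ c ≠ b) := by
    intro c
    rw [hπ₀_apply, add_left_inj]
    by_cases hca : c = a
    · rw [hca, Equiv.swap_apply_left]; simpa using hab.symm
    by_cases hcb : c = b
    · rw [hcb, Equiv.swap_apply_right]; simpa using hab
    rw [Equiv.swap_apply_of_ne_of_ne hca hcb]; simp [hca, hcb]
  have huniq : ∀ π : Equiv.Perm (Fin (n + 1)), (∀ c, π c = c + k ↔ (c ≠ a ∧ c ≠ b)) → π = π₀ := by
    intro π hπ
    -- a non-block value `π c` is `a + k` or `b + k`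
    have hval : ∀ c, π c ≠ c + k → π c = a + k ∨ π c = b + k := by
      intro c hc
      by_contra h
      rw [not_or] at h
      have h' : π (π c - k) = π c - k + k :=
        (hπ (π c - k)).2 ⟨fun h1 => h.1 (by rw [← h1, sub_add_cancel]),
          fun h2 => h.2 (by rw [← h2, sub_add_cancel])⟩
      rw [sub_add_cancel] at h'
      exact hc (sub_eq_iff_eq_add.1 (π.injective h'))
    have ha : π a ≠ a + k := fun h => ((hπ a).1 h).1 rfl
    have hb : π b ≠ b + k := fun h => ((hπ b).1 h).2 rfl
    have ha' : π a = b + k := ((hval a ha).resolve_left ha)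
    have hb' : π b = a + k := (hval b hb).resolve_right hb
    ext c : 1
    rw [hπ₀_apply]
    by_cases hca : c = a
    · rw [hca, Equiv.swap_apply_left, ha']
    by_cases hcb : c = b
    · rw [hcb, Equiv.swap_apply_right, hb']
    rw [Equiv.swap_apply_of_ne_of_ne hca hcb, (hπ c).2 ⟨hca, hcb⟩]
  -- expand `φ_k (per)` termwise and read off the coefficient
  simp only [perPoly, Matrix.permanent, Matrix.mvPolynomialX_apply, map_sum, map_prod, aeval_X,
    blockSplit_term, coeff_sum, coeff_monomial, blockExp_eq_iff]
  rw [Finset.sum_eq_single π₀]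
  · have hS : Finset.univ.filter (fun c => π₀ c = c + k) = ({a, b} : Finset (Fin (n + 1)))ᶜ := by
      ext c
      simp only [Finset.mem_filter, Finset.mem_univ, true_and, hfix c, Finset.mem_compl,
        Finset.mem_insert, Finset.mem_singleton, not_or]
    have hS' : Finset.univ.filter (fun c => ¬ π₀ c = c + k) = ({a, b} : Finset (Fin (n + 1))) := by
      ext c
      simp only [Finset.mem_filter, Finset.mem_univ, true_and, hfix c, Finset.mem_insert,
        Finset.mem_singleton, not_and_or, not_not]
    rw [if_pos hS, hS', Finset.prod_pair hab, hπ₀_apply, hπ₀_apply, Equiv.swap_apply_left,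
      Equiv.swap_apply_right]
  · intro π _ hne
    rw [if_neg]
    intro hS
    apply hne
    apply huniq
    intro c
    have h := Finset.ext_iff.1 hS c
    simpa using h
  · intro h
    exact absurd (Finset.mem_univ _) h

end Summit.ValiantsHypothesis.ValiantsHypothesis.Theorems.ElementaryWordLengthWordPerCubic

end
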